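import Literature.MathematicalPhysics.QuantumFieldTheory.Balaban1983to89.B5G183RateL2Op

/-!
# Bałaban [CMP 95 (1984)] (1.83)/(1.89) at `U = 1`, ORDER-ONE derivative weights: the operator-norm
ASSEMBLY of the eta-RATE of `∇G`, `G∇*` between the levels `N` and `RN` — the typed residual S2 of
`B5G183RateL2Op` (`OrderOneOpRateResidualL/R`) PROVED with an explicit constant `Casm d a`

HONEST FRAMING (cell `pub-balaban`, T⁴ programme, estimate NE2 = U1a «η-rate, linear theory»).  This
module finishes the order-one part of the scheme of `B5G183RateL2Op` for Bałaban's operator `G` of (1.83)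
([Balaban1984PropagatorsI] p. 31) on a FINITE torus with lattice spacing `η = 1/n` and the trivial
background `U = 1`, at a fixed NONZERO reduced momentum `p′ = s` of the Brillouin zone, fibrewise: for the
ORDER-ONE items `∇G`, `G∇*` of Prop. 1.1 (1.89) p. 33 (uniform bound: b05's reviewed
`B5Prop11Fiber.opNorm_D_G_le` / `opNorm_G_D_le`; NO rate is printed by Bałaban) it proves the eta-RATE
`‖D_{∂^{(RN)}_ν} G^{(RN)}(p′) − plant_R(D_{∂^{(N)}_ν} G^{(N)}(p′))‖_op ≤ Casm(d,a)/N` (and the right-weight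
twin), i.e. the `Prop`s `OrderOneOpRateResidualL d a (Casm d a)` and `OrderOneOpRateResidualR d a (Casm d a)`
typed — and there NOT proved — in `B5G183RateL2Op` §4.  What is done HERE is matrix bookkeeping only: the
entry formula of the weighted difference, the splitting of the double index sum over King's `m = 0` pairing
regions ([King1986] §4 p. 672) and the `d²` block directions, the Hilbert–Schmidt total, «free diagonal by
SUP + the rest by HILBERT–SCHMIDT» (`B5G183RateL2Op.opNorm_le_diag_add_hs'`), and hermiticity for the right
weight; every analytic estimate is imported from `B5G183RateL2Op`.  Nothing here is infinite-volume, a mass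
gap, uniform in a coupling, a statement about `U ≠ 1`, or progress on any Clay problem or on the summit
statement of this programme.  King's rates ([King1986] §4) are for the scalar kernels with averaging
operators; the pairing / currencies / constants are OURS.  All theorems `[folklore]`; `[cite: …]` tags
locate TEXT, never a proof.

WHAT IS PRINTED (renders read as images by this seat: [Balaban1984PropagatorsI] pp. 31, 32, 33; [King1986]
pp. 672, 673).  Bałaban p. 33: «Proposition 1.1. The operator G is a symmetric operator on L²(T_η) and ‖GJ‖,
‖∇GJ‖, ‖G∇*J‖, ‖∇G∇*J‖, ‖∇∇GJ‖, ‖G∇*∇*J‖ ≤ γ₀⁻¹‖J‖, (1.89) with a positive constant γ₀ independent of k,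
T_η, and depending on d only (if we put a = 1). This implies the bound from below: Δ_a = G⁻¹ ≥ γ₀(Δ + I).
(1.90)»; p. 32: «It is bounded also when differentiated two times at most.»  King p. 672: «To analyze the
m = 0 term in (4.19), we successively replace each factor by the corresponding one … and bound the error. We
must always be careful to keep enough negative powers of momentum so that» (the alias sums converge), with
the legends of (4.22) «… ≤ C for α < 1.» and (4.23) «≤ CL^{−γk} for α + γ < 1».  The typed (1.83) fibre is
b05's `B5Prop11Fiber.balabanFiber` (Hermitian: `G_isHermitian`); its entries in King's variables are
`B5G183RateOp.G_entry` / `Gfor` (free diagonal `Δ(q_k)⁻¹`, x-block `xEnt`, rank-one block `rEnt`, the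
(1.87)-corner `dZ` via `xEnt_zero_zero`); the order-one weight is b05's `dSym n k p′ ν = ∂^{(n)}_ν(p′ + 2πk)`;
planting is `B5G183RateOp.plant` (King's pairing `ι = B5Hk163Rate.iota`).

WHAT IS TYPED HERE (hypotheses `|p′_ν| ≤ π`, `p′ ≠ 0`, `0 < a`, `1 ≤ N`, `1 ≤ R` only):
 * §1 the objects: `Xdiff` (the left-weighted difference, definitionally the matrix of the residual), its
   diagonal part `Dg` (free-diagonal weight differences on King's paired classes `≠ ι0`, the full weighted
   free diagonal on the unpaired ones, `0` at `ι0`), `norm_Dg_le` (`≤ (Cdg + π/4)/N`), the entry formulas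
   `Xdiff_iota_iota` / `Xdiff_iota_unpaired` / `Xdiff_unpaired` and the entrywise majorants of `X − D`
   (`entry_iota_iota_le` with the x-part `Xi` — corner at `(0,0)` —, `entry_iota_unpaired_le`,
   `entry_unpaired_le`);
 * §3 the regional squared Hilbert–Schmidt sums of `X − D`: `sum_Xi_sq_le` (`≤ CPPx/N²`),
   `hs_paired_paired_le`, `hs_paired_unpaired_le` (`/N⁴`), `hs_unpaired_le`;
 * §4 `hs_total_le` (`Σ_{i,j} ‖X_{ij} − [i=j]D(i)‖² ≤ Chs/N²`), `Casm d a = Cdg + π/4 + √Chs`, the rate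
   `opNorm_D_G_rate` (`‖Xdiff‖ ≤ Casm/N`) and `orderOneOpRateResidualL_holds : OrderOneOpRateResidualL d a
   (Casm d a)`;
 * §5 the right weight by hermiticity: `sandwich_right_eq_conjTranspose`, `plant_conjTranspose`,
   `opNorm_G_D_rate`, `orderOneOpRateResidualR_holds : OrderOneOpRateResidualR d a (Casm d a)`, and the
   summary `orderOne_uniform_and_rate` (uniform `γ₀(d,a)` of b05 AND rate `Casm/N`, both weights).
 NO conditional of the cell is used or mentioned in any signature (no BetaPertH / (B) / (B^μ)).

WHAT IS NOT CLAIMED: (i) anything for the ORDER-TWO items `∇G∇*`, `∇∇G`, `G∇*∇*` of (1.89), whose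
free-diagonal weight has NO uniform η-rate at symbol level (`B5G183RateObstruction.order_two_weight_no_rate`)
— an η-rate for them needs an input beyond this scheme; (ii) `p′`-derivatives of the fibres, the momentum
integral `∫dp′` / the identification with Bałaban's `L²(T_η)` operators and position-space kernels, their
exponential decay, `U ≠ 1`, optimal constants (`Casm` is a crude closed form, of size a fixed power of `d`,
`π`, `γ₀⁻¹`, `a⁻¹`); (iii) any claim about print beyond the located quotations above — in particular Bałaban
prints NO rate and King prints rates only for the scalar averaging kernels.
-/

noncomputable section

namespace Literature.MathematicalPhysics.QuantumFieldTheory.Balaban1983to89.B5G183RateL2Asm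

open scoped BigOperators ComplexConjugate Matrix.Norms.L2Operator
open Finset Complex
open Literature.MathematicalPhysics.QuantumFieldTheory.Balaban1983to89.B4Strip
open Literature.MathematicalPhysics.QuantumFieldTheory.Balaban1983to89.B5Prop11Leaves
open Literature.MathematicalPhysics.QuantumFieldTheory.Balaban1983to89.B5Prop11Fiber
open Literature.MathematicalPhysics.QuantumFieldTheory.Balaban1983to89.B5Prop11Bound
open Literature.MathematicalPhysics.QuantumFieldTheory.Balaban1983to89.B5ActionRate166 (Cphi Cpsi)
open Literature.MathematicalPhysics.QuantumFieldTheory.Balaban1983to89.B5Hk163Rate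
open Literature.MathematicalPhysics.QuantumFieldTheory.Balaban1983to89.B5Hk163RateSum
open Literature.MathematicalPhysics.QuantumFieldTheory.Balaban1983to89.B5G183Rate
open Literature.MathematicalPhysics.QuantumFieldTheory.Balaban1983to89.B5G183RateSum
open Literature.MathematicalPhysics.QuantumFieldTheory.Balaban1983to89.B5G183RateOp
open Literature.MathematicalPhysics.QuantumFieldTheory.Balaban1983to89.B5G183RateL2
open Literature.MathematicalPhysics.QuantumFieldTheory.Balaban1983to89.B5G183RateL2Op
open Literature.MathematicalPhysics.QuantumFieldTheory.King1986

variable {d : ℕ}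

/-! ## §1 The objects: the weighted difference `X`, its diagonal part `D`, entry formulas [folklore] -/

section Objects

variable {N R : ℕ} [NeZero N] [NeZero R]

/-- the ORDER-ONE weighted difference of the left-weight residual:
`X = D_{∂^{(RN)}_ν} G^{(RN)}(p′) − plant_R(D_{∂^{(N)}_ν} G^{(N)}(p′))` on the level-`RN` classes `× Fin d`
(b05's `sandwich` with right weight `1`, `B5G183RateOp.plant`). [cite: Balaban1984PropagatorsI, (1.89) p.33] [folklore] -/
def Xdiff (N R : ℕ) [NeZero N] [NeZero R] (hN : 1 ≤ N) (hRN : 1 ≤ R * N) (a : ℝ) (ha : 0 < a)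
    (s : Fin d → ℝ) (hs : ∀ ν, |s ν| ≤ Real.pi) (hs0 : s ≠ 0) (ν : Fin d) :
    Matrix ((Fin d → Fin (R * N)) × Fin d) ((Fin d → Fin (R * N)) × Fin d) ℂ :=
  sandwich (fun k'' => dSym (R * N) k'' s ν) (fun _ => (1 : ℂ)) (balabanFiber (R * N) hRN a ha s hs hs0).G
    - plant R s (sandwich (fun k => dSym N k s ν) (fun _ => (1 : ℂ)) (balabanFiber N hN a ha s hs hs0).G)

/-- the DIAGONAL PART of `X` kept for the sup bound: on an unpaired class `w·Δ⁻¹(q″)`; on a paired class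
`ιk`, `k ≠ 0`, the difference `w^{(RN)}(q_k)Δ^{(RN)}(q_k)⁻¹ − w^{(N)}(q_k)Δ^{(N)}(q_k)⁻¹`; `0` at the zone
centre `ι0` (whose diagonal goes with the `(0,0)` x-entry into the (1.87)-corner). [folklore] -/
def Dg (N R : ℕ) [NeZero N] [NeZero R] (s : Fin d → ℝ) (ν : Fin d) (K : Fin d → Fin (R * N)) : ℂ :=
  match unpair R s K with
  | none => dSym (R * N) K s ν * (((DeltaXir (R * N) 0 (symmAlias (R * N) K s) : ℝ) : ℂ))⁻¹
  | some k => if k = 0 then 0 else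
      dSym (R * N) K s ν * (((DeltaXir (R * N) 0 (symmAlias (R * N) K s) : ℝ) : ℂ))⁻¹
        - dSym N k s ν * (((DeltaXir N 0 (symmAlias N k s) : ℝ) : ℂ))⁻¹

/-- `D` at a paired class. [folklore] -/
theorem Dg_iota (hN : 1 ≤ N) {s : Fin d → ℝ} (hs : ∀ ν, |s ν| ≤ Real.pi) (ν : Fin d)
    (k : Fin d → Fin N) :
    Dg N R s ν (iota R k s) = if k = 0 then 0 else
      dSym (R * N) (iota R k s) s ν
          * (((DeltaXir (R * N) 0 (symmAlias (R * N) (iota R k s) s) : ℝ) : ℂ))⁻¹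
        - dSym N k s ν * (((DeltaXir N 0 (symmAlias N k s) : ℝ) : ℂ))⁻¹ := by
  unfold Dg
  simp only [unpair_iota hN hs]

/-- `D` at an unpaired class. [folklore] -/
theorem Dg_unpaired {s : Fin d → ℝ} (ν : Fin d) {K : Fin d → Fin (R * N)}
    (hu : ∀ k : Fin d → Fin N, iota R k s ≠ K) :
    Dg N R s ν K = dSym (R * N) K s ν * (((DeltaXir (R * N) 0 (symmAlias (R * N) K s) : ℝ) : ℂ))⁻¹ := by
  unfold Dg
  simp only [unpair_of_unpaired hu]

/-- **SUP bound of the diagonal part:** `‖D(K)‖ ≤ (Cdg + π/4)/N` for every class `K` of level `RN`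
(`diag_weight_rate_le` on the paired classes, `diag_weight_unpaired_le` on the unpaired ones, `0` at `ι0`).
[cite: King1986, (4.20), (4.23) p.672] [folklore] -/
theorem norm_Dg_le (hN : 1 ≤ N) (hR : 1 ≤ R) {s : Fin d → ℝ} (hs : ∀ ν, |s ν| ≤ Real.pi)
    (ν₀ : Fin d) (hν₀ : s ν₀ ≠ 0) (ν : Fin d) (K : Fin d → Fin (R * N)) :
    ‖Dg N R s ν K‖ ≤ (Cdg + Real.pi / 4) / N := by
  have hπ := Real.pi_pos
  have hN0 : (0 : ℝ) < N := by exact_mod_cast hN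
  have hC := Cdg_nonneg
  by_cases hp : ∃ k : Fin d → Fin N, iota R k s = K
  · obtain ⟨k, rfl⟩ := hp
    rw [Dg_iota hN hs ν k]
    split_ifs with hk
    · rw [norm_zero]; positivity
    · calc _ ≤ Cdg / N := diag_weight_rate_le hN hR hs ν₀ hν₀ k ν
        _ ≤ (Cdg + Real.pi / 4) / N := by gcongr; linarith
  · push Not at hp
    rw [Dg_unpaired ν hp]
    calc _ ≤ Real.pi / (4 * N) := diag_weight_unpaired_le hN hR hs hp ν
      _ = (Real.pi / 4) / N := by rw [div_div]
      _ ≤ (Cdg + Real.pi / 4) / N := by gcongr; linarith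

/-- entries of `X` at (paired, paired) classes. [folklore] -/
theorem Xdiff_iota_iota (hN : 1 ≤ N) (hRN : 1 ≤ R * N) (a : ℝ) (ha : 0 < a) {s : Fin d → ℝ}
    (hs : ∀ ν, |s ν| ≤ Real.pi) (hs0 : s ≠ 0) (ν : Fin d) (k k' : Fin d → Fin N) (μ μ' : Fin d) :
    Xdiff N R hN hRN a ha s hs hs0 ν (iota R k s, μ) (iota R k' s, μ')
      = dSym (R * N) (iota R k s) s ν * Gfor (R * N) a s μ μ' (iota R k s) (iota R k' s)
        - dSym N k s ν * Gfor N a s μ μ' k k' := by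
  unfold Xdiff
  rw [Matrix.sub_apply, plant_iota_iota hN hs]
  unfold sandwich
  simp only [map_one, mul_one]
  rw [G_entry, G_entry]

/-- entries of `X` at (paired row, unpaired column): the planted operator vanishes. [folklore] -/
theorem Xdiff_iota_unpaired (hN : 1 ≤ N) (hRN : 1 ≤ R * N) (a : ℝ) (ha : 0 < a) {s : Fin d → ℝ}
    (hs : ∀ ν, |s ν| ≤ Real.pi) (hs0 : s ≠ 0) (ν : Fin d) (k : Fin d → Fin N) (μ : Fin d)
    {K' : Fin d → Fin (R * N)} (hu : ∀ k₁ : Fin d → Fin N, iota R k₁ s ≠ K') (μ' : Fin d) :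
    Xdiff N R hN hRN a ha s hs hs0 ν (iota R k s, μ) (K', μ')
      = dSym (R * N) (iota R k s) s ν * Gfor (R * N) a s μ μ' (iota R k s) K' := by
  unfold Xdiff
  rw [Matrix.sub_apply, plant_col_unpaired _ _ hu, sub_zero]
  unfold sandwich
  simp only [map_one, mul_one]
  rw [G_entry]

/-- entries of `X` on an unpaired row: the planted operator vanishes. [folklore] -/
theorem Xdiff_unpaired (hN : 1 ≤ N) (hRN : 1 ≤ R * N) (a : ℝ) (ha : 0 < a) {s : Fin d → ℝ}
    (hs : ∀ ν, |s ν| ≤ Real.pi) (hs0 : s ≠ 0) (ν : Fin d) {K : Fin d → Fin (R * N)}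
    (hu : ∀ k₁ : Fin d → Fin N, iota R k₁ s ≠ K) (μ : Fin d) (K' : Fin d → Fin (R * N)) (μ' : Fin d) :
    Xdiff N R hN hRN a ha s hs hs0 ν (K, μ) (K', μ')
      = dSym (R * N) K s ν * Gfor (R * N) a s μ μ' K K' := by
  unfold Xdiff
  rw [Matrix.sub_apply, plant_row_unpaired _ hu, sub_zero]
  unfold sandwich
  simp only [map_one, mul_one]
  rw [G_entry]

omit [NeZero N] [NeZero R] in
/-- squaring `x ≤ [c]·A + B`: `x² ≤ [c]·2A² + 2B²`. [folklore] -/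
theorem sq_le_two_ite {x A B : ℝ} {c : Prop} [Decidable c] (hx : 0 ≤ x) (hA : 0 ≤ A) (hB : 0 ≤ B)
    (h : x ≤ (if c then A else 0) + B) : x ^ 2 ≤ (if c then 2 * A ^ 2 else 0) + 2 * B ^ 2 := by
  split_ifs at h ⊢ with hc
  · nlinarith [sq_nonneg (A - B), mul_nonneg (sub_nonneg.2 h) (add_nonneg (add_nonneg hA hB) hx)]
  · nlinarith [mul_nonneg (sub_nonneg.2 h) (add_nonneg hB hx)]

/-- **entry bound on an UNPAIRED ROW:** the free diagonal cancels against `D` exactly and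
`‖X_{(K,μ),(K′,μ′)} − [=]D(K)‖ ≤ [μ=μ′]‖w(K)xEnt(K,K′)‖ + ‖w(K)rEnt_{μμ′}(K,K′)‖`. [folklore] -/
theorem entry_unpaired_le (hN : 1 ≤ N) (hRN : 1 ≤ R * N) (a : ℝ) (ha : 0 < a) {s : Fin d → ℝ}
    (hs : ∀ ν, |s ν| ≤ Real.pi) (hs0 : s ≠ 0) (ν : Fin d) {K : Fin d → Fin (R * N)}
    (hu : ∀ k₁ : Fin d → Fin N, iota R k₁ s ≠ K) (μ : Fin d) (K' : Fin d → Fin (R * N)) (μ' : Fin d) :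
    ‖Xdiff N R hN hRN a ha s hs hs0 ν (K, μ) (K', μ')
        - (if (K, μ) = (K', μ') then Dg N R s ν K else 0)‖
      ≤ (if μ = μ' then ‖dSym (R * N) K s ν * xEnt (R * N) a μ s K K'‖ else 0)
        + ‖dSym (R * N) K s ν * rEnt (R * N) a μ μ' s K K'‖ := by
  rw [Xdiff_unpaired hN hRN a ha hs hs0 ν hu, Dg_unpaired ν hu]
  unfold Gfor
  set w := dSym (R * N) K s ν
  set A : ℂ := (((DeltaXir (R * N) 0 (symmAlias (R * N) K s) : ℝ) : ℂ))⁻¹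
  set x := xEnt (R * N) a μ s K K'
  set r := rEnt (R * N) a μ μ' s K K'
  by_cases hμ : μ = μ'
  · subst hμ
    simp only [if_true, Prod.mk.injEq, and_true]
    by_cases hK : K = K'
    · subst hK
      simp only [if_true]
      have e : w * ((A - x) + r) - w * A = -(w * x) + w * r := by ring
      rw [e]
      exact (norm_add_le _ _).trans (by rw [norm_neg])
    · simp only [hK, if_false, zero_sub, sub_zero]
      have e : w * (-x + r) = -(w * x) + w * r := by ring
      rw [e]
      exact (norm_add_le _ _).trans (by rw [norm_neg])
  · have hne : ¬ ((K, μ) = (K', μ')) := fun h => hμ (Prod.mk.injEq _ _ _ _ ▸ h).2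
    simp only [hμ, if_false, zero_add, hne, sub_zero]
    exact le_refl _

/-- **entry bound at (PAIRED ROW `ιk`, UNPAIRED COLUMN `K′`):** planted operator and `D` vanish,
`‖X‖ ≤ [μ=μ′]‖w(ιk)xEnt(ιk,K′)‖ + ‖w(ιk)rEnt_{μμ′}(ιk,K′)‖`. [folklore] -/
theorem entry_iota_unpaired_le (hN : 1 ≤ N) (hRN : 1 ≤ R * N) (a : ℝ) (ha : 0 < a) {s : Fin d → ℝ}
    (hs : ∀ ν, |s ν| ≤ Real.pi) (hs0 : s ≠ 0) (ν : Fin d) (k : Fin d → Fin N) (μ : Fin d)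
    {K' : Fin d → Fin (R * N)} (hu : ∀ k₁ : Fin d → Fin N, iota R k₁ s ≠ K') (μ' : Fin d) :
    ‖Xdiff N R hN hRN a ha s hs hs0 ν (iota R k s, μ) (K', μ')
        - (if (iota R k s, μ) = (K', μ') then Dg N R s ν (iota R k s) else 0)‖
      ≤ (if μ = μ' then ‖dSym (R * N) (iota R k s) s ν * xEnt (R * N) a μ s (iota R k s) K'‖ else 0)
        + ‖dSym (R * N) (iota R k s) s ν * rEnt (R * N) a μ μ' s (iota R k s) K'‖ := by
  have hne : iota R k s ≠ K' := hu k
  have hne2 : ¬ ((iota R k s, μ) = (K', μ')) := fun h => hne (Prod.mk.injEq _ _ _ _ ▸ h).1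
  rw [Xdiff_iota_unpaired hN hRN a ha hs hs0 ν k μ hu]
  simp only [hne2, if_false, sub_zero]
  unfold Gfor
  simp only [hne, if_false, zero_sub]
  set w := dSym (R * N) (iota R k s) s ν
  set x := xEnt (R * N) a μ s (iota R k s) K'
  set r := rEnt (R * N) a μ μ' s (iota R k s) K'
  by_cases hμ : μ = μ'
  · subst hμ
    simp only [if_true]
    have e : w * (-x + r) = -(w * x) + w * r := by ring
    rw [e]
    exact (norm_add_le _ _).trans (by rw [norm_neg])
  · simp only [hμ, if_false, zero_add]
    exact le_refl _

end Objects

/-! ## §2 The entry bound at (paired, paired) classes: x-part with the (1.87)-corner, rank-one part [folklore] -/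

section Paired

variable {N R : ℕ} [NeZero N] [NeZero R]

/-- the x-PART MAJORANT at paired classes `(ιk, ιk′)`, block direction `μ`, weight direction `ν`: at the
zone centre `(0,0)` the weighted (1.87)-corner `‖∂^{(RN)}(p′)dZ^{(RN)} − ∂^{(N)}(p′)dZ^{(N)}‖` (free diagonal
and `(0,0)` x-entry together), elsewhere the weighted x-entry difference. [folklore] -/
def Xi (N R : ℕ) [NeZero N] [NeZero R] (a : ℝ) (μ : Fin d) (s : Fin d → ℝ) (ν : Fin d)
    (k k' : Fin d → Fin N) : ℝ :=
  if k = 0 ∧ k' = 0 then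
    ‖dSym (R * N) 0 s ν * ((dZ (R * N) a μ s : ℝ) : ℂ) - dSym N 0 s ν * ((dZ N a μ s : ℝ) : ℂ)‖
  else ‖dSym (R * N) (iota R k s) s ν * xEnt (R * N) a μ s (iota R k s) (iota R k' s)
        - dSym N k s ν * xEnt N a μ s k k'‖

/-- `0 ≤ Xi`. [folklore] -/
theorem Xi_nonneg (a : ℝ) (μ : Fin d) (s : Fin d → ℝ) (ν : Fin d) (k k' : Fin d → Fin N) :
    0 ≤ Xi N R a μ s ν k k' := by
  unfold Xi; split_ifs <;> exact norm_nonneg _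

/-- **entry bound at (PAIRED, PAIRED) classes:**
`‖X_{(ιk,μ),(ιk′,μ′)} − [=]D(ιk)‖ ≤ [μ=μ′]·Xi(k,k′) + ‖w^{(RN)}rEnt^{(RN)}_{μμ′}(ιk,ιk′) − w^{(N)}rEnt^{(N)}_{μμ′}(k,k′)‖`
— on the diagonal `k = k′ ≠ 0` the free diagonal is absorbed by `D`; at `k = k′ = 0` the free diagonal and
the `(0,0)` x-entry combine to the (1.87) scalar `dZ` (`B5G183RateOp.xEnt_zero_zero`). [cite:
Balaban1984PropagatorsI, (1.83) p.31, (1.87) p.32; King1986, (4.19)–(4.21) p.672] [folklore] -/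
theorem entry_iota_iota_le (hN : 1 ≤ N) (hRN : 1 ≤ R * N) (a : ℝ) (ha : 0 < a) {s : Fin d → ℝ}
    (hs : ∀ ν, |s ν| ≤ Real.pi) (hs0 : s ≠ 0) (ν : Fin d) (k k' : Fin d → Fin N) (μ μ' : Fin d) :
    ‖Xdiff N R hN hRN a ha s hs hs0 ν (iota R k s, μ) (iota R k' s, μ')
        - (if (iota R k s, μ) = (iota R k' s, μ') then Dg N R s ν (iota R k s) else 0)‖
      ≤ (if μ = μ' then Xi N R a μ s ν k k' else 0)
        + ‖dSym (R * N) (iota R k s) s ν * rEnt (R * N) a μ μ' s (iota R k s) (iota R k' s)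
            - dSym N k s ν * rEnt N a μ μ' s k k'‖ := by
  have hinj : iota R k s = iota R k' s ↔ k = k' :=
    ⟨fun h => iota_injective hN hs h, fun h => by rw [h]⟩
  rw [Xdiff_iota_iota hN hRN a ha hs hs0 ν k k' μ μ', Dg_iota hN hs ν k]
  by_cases hμ : μ = μ'
  · subst hμ
    by_cases hk : k = k'
    · subst hk
      by_cases h0 : k = 0
      · subst h0
        have hι : iota R (0 : Fin d → Fin N) s = 0 := iota_zero hN hs
        simp only [hι, and_self, if_true, sub_zero, Xi]
        unfold Gfor
        simp only [if_true]
        rw [xEnt_zero_zero hRN a ha μ hs hs0, xEnt_zero_zero hN a ha μ hs hs0,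
          symmAlias_zero hRN hs, symmAlias_zero hN hs]
        set wR := dSym (R * N) (0 : Fin d → Fin (R * N)) s ν
        set wN := dSym N (0 : Fin d → Fin N) s ν
        set AR : ℂ := (((DeltaXir (R * N) 0 s : ℝ) : ℂ))⁻¹
        set AN : ℂ := (((DeltaXir N 0 s : ℝ) : ℂ))⁻¹
        set zR : ℂ := ((dZ (R * N) a μ s : ℝ) : ℂ)
        set zN : ℂ := ((dZ N a μ s : ℝ) : ℂ)
        set rR := rEnt (R * N) a μ μ s 0 0
        set rN := rEnt N a μ μ s 0 0
        have e : wR * ((AR - (AR - zR)) + rR) - wN * ((AN - (AN - zN)) + rN)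
            = (wR * zR - wN * zN) + (wR * rR - wN * rN) := by ring
        rw [e]
        exact norm_add_le _ _
      · simp only [and_self, if_true, h0, if_false, Xi]
        unfold Gfor
        simp only [if_true]
        set wR := dSym (R * N) (iota R k s) s ν
        set wN := dSym N k s ν
        set AR : ℂ := (((DeltaXir (R * N) 0 (symmAlias (R * N) (iota R k s) s) : ℝ) : ℂ))⁻¹
        set AN : ℂ := (((DeltaXir N 0 (symmAlias N k s) : ℝ) : ℂ))⁻¹
        set xR := xEnt (R * N) a μ s (iota R k s) (iota R k s)
        set xN := xEnt N a μ s k k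
        set rR := rEnt (R * N) a μ μ s (iota R k s) (iota R k s)
        set rN := rEnt N a μ μ s k k
        have e : wR * ((AR - xR) + rR) - wN * ((AN - xN) + rN) - (wR * AR - wN * AN)
            = -(wR * xR - wN * xN) + (wR * rR - wN * rN) := by ring
        rw [e]
        exact (norm_add_le _ _).trans (by rw [norm_neg])
    · have hι : ¬ iota R k s = iota R k' s := fun h => hk (hinj.mp h)
      have h00 : ¬ (k = 0 ∧ k' = 0) := fun h => hk (h.1.trans h.2.symm)
      simp only [Prod.mk.injEq, hι, false_and, if_false, sub_zero, if_true, Xi, h00]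
      unfold Gfor
      simp only [if_true, hι, hk, if_false, zero_sub]
      set wR := dSym (R * N) (iota R k s) s ν
      set wN := dSym N k s ν
      set xR := xEnt (R * N) a μ s (iota R k s) (iota R k' s)
      set xN := xEnt N a μ s k k'
      set rR := rEnt (R * N) a μ μ s (iota R k s) (iota R k' s)
      set rN := rEnt N a μ μ s k k'
      have e : wR * (-xR + rR) - wN * (-xN + rN) = -(wR * xR - wN * xN) + (wR * rR - wN * rN) := by ring
      rw [e]
      exact (norm_add_le _ _).trans (by rw [norm_neg])
  · have hne : ¬ ((iota R k s, μ) = (iota R k' s, μ')) := fun h => hμ (Prod.mk.injEq _ _ _ _ ▸ h).2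
    simp only [hne, hμ, if_false, sub_zero, zero_add]
    unfold Gfor
    simp only [hμ, if_false, zero_add]
    exact le_refl _

end Paired

/-! ## §3 The regional Hilbert–Schmidt sums of `X − D` over King's pairing [folklore] -/

section Sums

variable {N R : ℕ} [NeZero N] [NeZero R]

omit [NeZero N] [NeZero R] in
/-- bookkeeping: `Σ_{k′∈S} Σ_{μ′} ([μ = μ′]·A(k′) + B(μ′,k′)) = Σ_{k′∈S} A(k′) + Σ_{μ′} Σ_{k′∈S} B(μ′,k′)`. [folklore] -/
theorem sum_sum_ite_add' {α : Type*} (S : Finset α) (μ : Fin d) (A : α → ℝ) (B : Fin d → α → ℝ) :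
    ∑ k' ∈ S, ∑ μ' : Fin d, ((if μ = μ' then A k' else 0) + B μ' k')
      = ∑ k' ∈ S, A k' + ∑ μ' : Fin d, ∑ k' ∈ S, B μ' k' := by
  have h : ∀ k', ∑ μ' : Fin d, ((if μ = μ' then A k' else 0) + B μ' k') = A k' + ∑ μ', B μ' k' :=
    fun k' => by rw [Finset.sum_add_distrib, Finset.sum_ite_eq]; simp
  rw [Finset.sum_congr rfl fun k' _ => h k', Finset.sum_add_distrib, Finset.sum_comm]

omit [NeZero N] [NeZero R] in
/-- bookkeeping: `Σ_x Σ_y c·f = c·Σ_x Σ_y f`. [folklore] -/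
theorem sum_sum_const_mul {α β : Type*} (S : Finset α) (T : Finset β) (c : ℝ) (f : α → β → ℝ) :
    ∑ x ∈ S, ∑ y ∈ T, c * f x y = c * ∑ x ∈ S, ∑ y ∈ T, f x y := by
  rw [Finset.mul_sum]
  exact Finset.sum_congr rfl fun x _ => (Finset.mul_sum _ _ _).symm

omit [NeZero N] [NeZero R] in
/-- the regional constants of `B5G183RateL2Op` are nonnegative. [folklore] -/
theorem consts_nonneg (d : ℕ) (a : ℝ) :
    (0 ≤ CxxR d ∧ 0 ≤ CrrR d a ∧ 0 ≤ Cx0row d ∧ 0 ≤ Cx0col d)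
      ∧ (0 ≤ CxU d ∧ 0 ≤ CxU' d ∧ 0 ≤ CrU d a ∧ 0 ≤ CrU' d a) := by
  obtain ⟨c, hc⟩ : ∃ c : ℝ, c ^ 2 = CW d := ⟨Real.sqrt (CW d), Real.sq_sqrt (CW_nonneg d)⟩
  refine ⟨⟨?_, ?_, ?_, ?_⟩, ⟨?_, ?_, ?_, ?_⟩⟩
  · unfold CxxR; rw [← hc]; positivity
  · unfold CrrR; rw [← hc]; positivity
  · unfold Cx0row; rw [← hc]; positivity
  · unfold Cx0col; rw [← hc]; positivity
  · unfold CxU; rw [← hc]; positivity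
  · unfold CxU'; rw [← hc]; positivity
  · unfold CrU; rw [← hc]; positivity
  · unfold CrU'; rw [← hc]; positivity

/-- constant of the x-part on (paired × paired). [folklore] -/
def CPPx (d : ℕ) (a : ℝ) : ℝ :=
  Ccorner d a ^ 2 + Cx0row d + Cx0col d + (4 * d / T4GaugeActionRate.gam0 d) ^ 2 * CxxR d

/-- **the x-part on (PAIRED × PAIRED):** `Σ_k Σ_{k′} Xi(k,k′)² ≤ CPPx/N²` — corner + row `0` + column `0` +
block `k, k′ ≠ 0` (`corner_weight_rate_le`, `xRow0_weight_hs_rate`, `xCol0_weight_hs_rate`,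
`xBlock_weight_hs_rate` with `Δ₀ ≤ 4d`). [cite: King1986, (4.19)–(4.22) p.672] [folklore] -/
theorem sum_Xi_sq_le (hN : 1 ≤ N) (hR : 1 ≤ R) (a : ℝ) (ha : 0 < a) (μ : Fin d) {s : Fin d → ℝ}
    (hs : ∀ ν, |s ν| ≤ Real.pi) (ν₀ : Fin d) (hν₀ : s ν₀ ≠ 0) (ν : Fin d) :
    ∑ k : Fin d → Fin N, ∑ k' : Fin d → Fin N, Xi N R a μ s ν k k' ^ 2 ≤ CPPx d a / (N : ℝ) ^ 2 := by
  classical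
  have hN0 : (0 : ℝ) < N := by exact_mod_cast hN
  have hγ := T4GaugeActionRate.gam0_pos d
  have hCxx := (consts_nonneg d a).1.1
  have hD : (Delta1r 0 s / T4GaugeActionRate.gam0 d) ^ 2 ≤ (4 * d / T4GaugeActionRate.gam0 d) ^ 2 :=
    pow_le_pow_left₀ (div_nonneg (Delta1r_nonneg 0 le_rfl s) hγ.le)
      (div_le_div_of_nonneg_right (Delta1r_le s) hγ.le) 2
  have h00 : Xi N R a μ s ν 0 0
      = ‖dSym (R * N) 0 s ν * ((dZ (R * N) a μ s : ℝ) : ℂ) - dSym N 0 s ν * ((dZ N a μ s : ℝ) : ℂ)‖ := by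
    simp only [Xi, and_self, if_true]
  have h0k : ∀ k' : Fin d → Fin N, k' ≠ 0 → Xi N R a μ s ν 0 k'
      = ‖dSym (R * N) (iota R 0 s) s ν * xEnt (R * N) a μ s (iota R 0 s) (iota R k' s)
          - dSym N 0 s ν * xEnt N a μ s 0 k'‖ := fun k' hk' => by
    simp only [Xi, hk', and_false, if_false]
  have hk0 : ∀ k : Fin d → Fin N, k ≠ 0 → ∀ k' : Fin d → Fin N, Xi N R a μ s ν k k'
      = ‖dSym (R * N) (iota R k s) s ν * xEnt (R * N) a μ s (iota R k s) (iota R k' s)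
          - dSym N k s ν * xEnt N a μ s k k'‖ := fun k hk k' => by
    simp only [Xi, hk, false_and, if_false]
  have hrow0 : ∑ k' : Fin d → Fin N, Xi N R a μ s ν 0 k' ^ 2
      ≤ Ccorner d a ^ 2 / (N : ℝ) ^ 2 + Cx0row d / (N : ℝ) ^ 2 := by
    rw [← Finset.add_sum_erase _ _ (Finset.mem_univ (0 : Fin d → Fin N)), h00]
    refine add_le_add ?_ ?_
    · rw [← div_pow]
      exact pow_le_pow_left₀ (norm_nonneg _) (corner_weight_rate_le hN hR a ha μ hs ν₀ hν₀ ν) 2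
    · calc ∑ k' ∈ Finset.univ.erase (0 : Fin d → Fin N), Xi N R a μ s ν 0 k' ^ 2
          = ∑ k' ∈ Finset.univ.erase (0 : Fin d → Fin N),
              ‖dSym (R * N) (iota R 0 s) s ν * xEnt (R * N) a μ s (iota R 0 s) (iota R k' s)
                - dSym N 0 s ν * xEnt N a μ s 0 k'‖ ^ 2 :=
            Finset.sum_congr rfl fun k' hk' => by rw [h0k k' (Finset.ne_of_mem_erase hk')]
        _ ≤ Cx0row d / (N : ℝ) ^ 2 := xRow0_weight_hs_rate hN hR a ha μ hs ν₀ hν₀ ν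
  have hrest : ∑ k ∈ Finset.univ.erase (0 : Fin d → Fin N), ∑ k' : Fin d → Fin N, Xi N R a μ s ν k k' ^ 2
      ≤ Cx0col d / (N : ℝ) ^ 2 + (4 * d / T4GaugeActionRate.gam0 d) ^ 2 * CxxR d / (N : ℝ) ^ 2 := by
    have e : ∀ k ∈ Finset.univ.erase (0 : Fin d → Fin N), ∑ k' : Fin d → Fin N, Xi N R a μ s ν k k' ^ 2
        = ‖dSym (R * N) (iota R k s) s ν * xEnt (R * N) a μ s (iota R k s) (iota R 0 s)
            - dSym N k s ν * xEnt N a μ s k 0‖ ^ 2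
          + ∑ k' ∈ Finset.univ.erase (0 : Fin d → Fin N),
              ‖dSym (R * N) (iota R k s) s ν * xEnt (R * N) a μ s (iota R k s) (iota R k' s)
                - dSym N k s ν * xEnt N a μ s k k'‖ ^ 2 := by
      intro k hk
      have hk' := Finset.ne_of_mem_erase hk
      rw [← Finset.add_sum_erase _ _ (Finset.mem_univ (0 : Fin d → Fin N)), hk0 k hk' 0]
      exact congrArg _ (Finset.sum_congr rfl fun k' _ => by rw [hk0 k hk' k'])
    rw [Finset.sum_congr rfl e, Finset.sum_add_distrib]
    refine add_le_add (xCol0_weight_hs_rate hN hR a ha μ hs ν₀ hν₀ ν) ?_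
    calc _ ≤ (Delta1r 0 s / T4GaugeActionRate.gam0 d) ^ 2 * CxxR d / (N : ℝ) ^ 2 :=
          xBlock_weight_hs_rate hN hR a ha μ hs ν₀ hν₀ ν
      _ ≤ (4 * d / T4GaugeActionRate.gam0 d) ^ 2 * CxxR d / (N : ℝ) ^ 2 :=
          div_le_div_of_nonneg_right (mul_le_mul_of_nonneg_right hD hCxx) (by positivity)
  rw [← Finset.add_sum_erase _ _ (Finset.mem_univ (0 : Fin d → Fin N))]
  calc _ ≤ (Ccorner d a ^ 2 / (N : ℝ) ^ 2 + Cx0row d / (N : ℝ) ^ 2)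
          + (Cx0col d / (N : ℝ) ^ 2 + (4 * d / T4GaugeActionRate.gam0 d) ^ 2 * CxxR d / (N : ℝ) ^ 2) :=
        add_le_add hrow0 hrest
    _ = CPPx d a / (N : ℝ) ^ 2 := by unfold CPPx; ring

/-- **(PAIRED × PAIRED) region, full `d × d` block structure, squared Hilbert–Schmidt norm of `X − D`:**
`≤ d·(2·CPPx + d·2·((4d+a)/a)²·CrrR)/N²`. [cite: King1986, (4.19)–(4.22) p.672] [folklore] -/
theorem hs_paired_paired_le (hN : 1 ≤ N) (hR : 1 ≤ R) (hRN : 1 ≤ R * N) (a : ℝ) (ha : 0 < a)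
    {s : Fin d → ℝ} (hs : ∀ ν, |s ν| ≤ Real.pi) (hs0 : s ≠ 0) (ν₀ : Fin d) (hν₀ : s ν₀ ≠ 0) (ν : Fin d) :
    ∑ k : Fin d → Fin N, ∑ μ : Fin d, ∑ k' : Fin d → Fin N, ∑ μ' : Fin d,
        ‖Xdiff N R hN hRN a ha s hs hs0 ν (iota R k s, μ) (iota R k' s, μ')
            - (if (iota R k s, μ) = (iota R k' s, μ') then Dg N R s ν (iota R k s) else 0)‖ ^ 2
      ≤ d * (2 * CPPx d a + d * (2 * (((4 * d + a) / a) ^ 2 * CrrR d a))) / (N : ℝ) ^ 2 := by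
  classical
  have hN0 : (0 : ℝ) < N := by exact_mod_cast hN
  set ρ : (Fin d → Fin N) → Fin d → (Fin d → Fin N) → Fin d → ℝ := fun k μ k' μ' =>
    ‖dSym (R * N) (iota R k s) s ν * rEnt (R * N) a μ μ' s (iota R k s) (iota R k' s)
        - dSym N k s ν * rEnt N a μ μ' s k k'‖ with hρdef
  have hpt : ∀ (k : Fin d → Fin N) (μ : Fin d) (k' : Fin d → Fin N) (μ' : Fin d),
      ‖Xdiff N R hN hRN a ha s hs hs0 ν (iota R k s, μ) (iota R k' s, μ')
          - (if (iota R k s, μ) = (iota R k' s, μ') then Dg N R s ν (iota R k s) else 0)‖ ^ 2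
        ≤ (if μ = μ' then 2 * Xi N R a μ s ν k k' ^ 2 else 0) + 2 * ρ k μ k' μ' ^ 2 :=
    fun k μ k' μ' => sq_le_two_ite (norm_nonneg _) (Xi_nonneg a μ s ν k k') (norm_nonneg _)
      (entry_iota_iota_le hN hRN a ha hs hs0 ν k k' μ μ')
  have hX : ∀ μ : Fin d, ∑ k : Fin d → Fin N, ∑ k' : Fin d → Fin N, 2 * Xi N R a μ s ν k k' ^ 2
      ≤ 2 * (CPPx d a / (N : ℝ) ^ 2) := fun μ => by
    rw [sum_sum_const_mul]
    exact mul_le_mul_of_nonneg_left (sum_Xi_sq_le hN hR a ha μ hs ν₀ hν₀ ν) (by norm_num)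
  have hRr : ∀ μ μ' : Fin d, ∑ k : Fin d → Fin N, ∑ k' : Fin d → Fin N, 2 * ρ k μ k' μ' ^ 2
      ≤ 2 * (((4 * d + a) / a) ^ 2 * CrrR d a / (N : ℝ) ^ 2) := fun μ μ' => by
    rw [sum_sum_const_mul]
    exact mul_le_mul_of_nonneg_left (rBlock_weight_hs_rate hN hR a ha μ μ' hs ν₀ hν₀ ν) (by norm_num)
  calc _ ≤ ∑ k : Fin d → Fin N, ∑ μ : Fin d, ∑ k' : Fin d → Fin N, ∑ μ' : Fin d,
            ((if μ = μ' then 2 * Xi N R a μ s ν k k' ^ 2 else 0) + 2 * ρ k μ k' μ' ^ 2) :=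
        Finset.sum_le_sum fun k _ => Finset.sum_le_sum fun μ _ => Finset.sum_le_sum fun k' _ =>
          Finset.sum_le_sum fun μ' _ => hpt k μ k' μ'
    _ = ∑ k : Fin d → Fin N, ∑ μ : Fin d,
          (∑ k' : Fin d → Fin N, 2 * Xi N R a μ s ν k k' ^ 2
            + ∑ μ' : Fin d, ∑ k' : Fin d → Fin N, 2 * ρ k μ k' μ' ^ 2) :=
        Finset.sum_congr rfl fun k _ => Finset.sum_congr rfl fun μ _ =>
          sum_sum_ite_add' Finset.univ μ (fun k' => 2 * Xi N R a μ s ν k k' ^ 2)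
            (fun μ' k' => 2 * ρ k μ k' μ' ^ 2)
    _ = ∑ μ : Fin d, ∑ k : Fin d → Fin N,
          (∑ k' : Fin d → Fin N, 2 * Xi N R a μ s ν k k' ^ 2
            + ∑ μ' : Fin d, ∑ k' : Fin d → Fin N, 2 * ρ k μ k' μ' ^ 2) := Finset.sum_comm
    _ = ∑ μ : Fin d, (∑ k : Fin d → Fin N, ∑ k' : Fin d → Fin N, 2 * Xi N R a μ s ν k k' ^ 2
          + ∑ μ' : Fin d, ∑ k : Fin d → Fin N, ∑ k' : Fin d → Fin N, 2 * ρ k μ k' μ' ^ 2) :=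
        Finset.sum_congr rfl fun μ _ => by
          rw [Finset.sum_add_distrib]
          congr 1
          exact Finset.sum_comm
    _ ≤ ∑ μ : Fin d, (2 * (CPPx d a / (N : ℝ) ^ 2)
          + ∑ μ' : Fin d, 2 * (((4 * d + a) / a) ^ 2 * CrrR d a / (N : ℝ) ^ 2)) :=
        Finset.sum_le_sum fun μ _ => add_le_add (hX μ) (Finset.sum_le_sum fun μ' _ => hRr μ μ')
    _ = d * (2 * CPPx d a + d * (2 * (((4 * d + a) / a) ^ 2 * CrrR d a))) / (N : ℝ) ^ 2 := by
        simp only [Finset.sum_const, Finset.card_univ, Fintype.card_fin]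
        ring

/-- **(PAIRED ROW × UNPAIRED COLUMN) region, squared Hilbert–Schmidt norm of `X − D`:**
`≤ d·(2·CxU′ + d·2·CrU′)/N⁴`. [cite: King1986, (4.19), (4.23) p.672] [folklore] -/
theorem hs_paired_unpaired_le (hN : 1 ≤ N) (hR : 1 ≤ R) (hRN : 1 ≤ R * N) (a : ℝ) (ha : 0 < a)
    {s : Fin d → ℝ} (hs : ∀ ν, |s ν| ≤ Real.pi) (hs0 : s ≠ 0) (ν₀ : Fin d) (hν₀ : s ν₀ ≠ 0) (ν : Fin d) :
    ∑ k : Fin d → Fin N, ∑ μ : Fin d,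
      ∑ K' ∈ Finset.univ.filter (fun K' => ∀ k₁ : Fin d → Fin N, iota R k₁ s ≠ K'), ∑ μ' : Fin d,
        ‖Xdiff N R hN hRN a ha s hs hs0 ν (iota R k s, μ) (K', μ')
            - (if (iota R k s, μ) = (K', μ') then Dg N R s ν (iota R k s) else 0)‖ ^ 2
      ≤ d * (2 * CxU' d + d * (2 * CrU' d a)) / (N : ℝ) ^ 4 := by
  classical
  have hN0 : (0 : ℝ) < N := by exact_mod_cast hN
  set T := Finset.univ.filter (fun K' => ∀ k₁ : Fin d → Fin N, iota R k₁ s ≠ K') with hTdef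
  set ξ : (Fin d → Fin N) → Fin d → (Fin d → Fin (R * N)) → ℝ := fun k μ K' =>
    ‖dSym (R * N) (iota R k s) s ν * xEnt (R * N) a μ s (iota R k s) K'‖ with hξdef
  set ρ : (Fin d → Fin N) → Fin d → (Fin d → Fin (R * N)) → Fin d → ℝ := fun k μ K' μ' =>
    ‖dSym (R * N) (iota R k s) s ν * rEnt (R * N) a μ μ' s (iota R k s) K'‖ with hρdef
  have hpt : ∀ (k : Fin d → Fin N) (μ : Fin d), ∀ K' ∈ T, ∀ μ' : Fin d,
      ‖Xdiff N R hN hRN a ha s hs hs0 ν (iota R k s, μ) (K', μ')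
          - (if (iota R k s, μ) = (K', μ') then Dg N R s ν (iota R k s) else 0)‖ ^ 2
        ≤ (if μ = μ' then 2 * ξ k μ K' ^ 2 else 0) + 2 * ρ k μ K' μ' ^ 2 := by
    intro k μ K' hK' μ'
    have hu := (Finset.mem_filter.mp hK').2
    exact sq_le_two_ite (norm_nonneg _) (norm_nonneg _) (norm_nonneg _)
      (entry_iota_unpaired_le hN hRN a ha hs hs0 ν k μ hu μ')
  have hX : ∀ μ : Fin d, ∑ k : Fin d → Fin N, ∑ K' ∈ T, 2 * ξ k μ K' ^ 2
      ≤ 2 * (CxU' d / (N : ℝ) ^ 4) := fun μ => by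
    rw [sum_sum_const_mul]
    exact mul_le_mul_of_nonneg_left (xUnpCol_weight_hs_le hN hR a ha μ hs ν₀ hν₀ ν) (by norm_num)
  have hRr : ∀ μ μ' : Fin d, ∑ k : Fin d → Fin N, ∑ K' ∈ T, 2 * ρ k μ K' μ' ^ 2
      ≤ 2 * (CrU' d a / (N : ℝ) ^ 4) := fun μ μ' => by
    rw [sum_sum_const_mul]
    exact mul_le_mul_of_nonneg_left (rUnpCol_weight_hs_le hN hR a ha μ μ' hs ν₀ hν₀ ν) (by norm_num)
  calc _ ≤ ∑ k : Fin d → Fin N, ∑ μ : Fin d, ∑ K' ∈ T, ∑ μ' : Fin d,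
            ((if μ = μ' then 2 * ξ k μ K' ^ 2 else 0) + 2 * ρ k μ K' μ' ^ 2) :=
        Finset.sum_le_sum fun k _ => Finset.sum_le_sum fun μ _ => Finset.sum_le_sum fun K' hK' =>
          Finset.sum_le_sum fun μ' _ => hpt k μ K' hK' μ'
    _ = ∑ k : Fin d → Fin N, ∑ μ : Fin d,
          (∑ K' ∈ T, 2 * ξ k μ K' ^ 2 + ∑ μ' : Fin d, ∑ K' ∈ T, 2 * ρ k μ K' μ' ^ 2) :=
        Finset.sum_congr rfl fun k _ => Finset.sum_congr rfl fun μ _ =>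
          sum_sum_ite_add' T μ (fun K' => 2 * ξ k μ K' ^ 2) (fun μ' K' => 2 * ρ k μ K' μ' ^ 2)
    _ = ∑ μ : Fin d, ∑ k : Fin d → Fin N,
          (∑ K' ∈ T, 2 * ξ k μ K' ^ 2 + ∑ μ' : Fin d, ∑ K' ∈ T, 2 * ρ k μ K' μ' ^ 2) := Finset.sum_comm
    _ = ∑ μ : Fin d, (∑ k : Fin d → Fin N, ∑ K' ∈ T, 2 * ξ k μ K' ^ 2
          + ∑ μ' : Fin d, ∑ k : Fin d → Fin N, ∑ K' ∈ T, 2 * ρ k μ K' μ' ^ 2) :=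
        Finset.sum_congr rfl fun μ _ => by
          rw [Finset.sum_add_distrib]
          congr 1
          exact Finset.sum_comm
    _ ≤ ∑ μ : Fin d, (2 * (CxU' d / (N : ℝ) ^ 4) + ∑ μ' : Fin d, 2 * (CrU' d a / (N : ℝ) ^ 4)) :=
        Finset.sum_le_sum fun μ _ => add_le_add (hX μ) (Finset.sum_le_sum fun μ' _ => hRr μ μ')
    _ = d * (2 * CxU' d + d * (2 * CrU' d a)) / (N : ℝ) ^ 4 := by
        simp only [Finset.sum_const, Finset.card_univ, Fintype.card_fin]
        ring

/-- **(UNPAIRED ROW × any column) region, squared Hilbert–Schmidt norm of `X − D`:**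
`≤ d·(2·CxU + d·2·CrU)/N²` (the free diagonal cancels against `D`). [cite: King1986, (4.19), (4.23) p.672]
[folklore] -/
theorem hs_unpaired_le (hN : 1 ≤ N) (hR : 1 ≤ R) (hRN : 1 ≤ R * N) (a : ℝ) (ha : 0 < a)
    {s : Fin d → ℝ} (hs : ∀ ν, |s ν| ≤ Real.pi) (hs0 : s ≠ 0) (ν₀ : Fin d) (hν₀ : s ν₀ ≠ 0) (ν : Fin d) :
    ∑ K ∈ Finset.univ.filter (fun K => ∀ k₁ : Fin d → Fin N, iota R k₁ s ≠ K), ∑ μ : Fin d,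
      ∑ K' : Fin d → Fin (R * N), ∑ μ' : Fin d,
        ‖Xdiff N R hN hRN a ha s hs hs0 ν (K, μ) (K', μ')
            - (if (K, μ) = (K', μ') then Dg N R s ν K else 0)‖ ^ 2
      ≤ d * (2 * CxU d + d * (2 * CrU d a)) / (N : ℝ) ^ 2 := by
  classical
  have hN0 : (0 : ℝ) < N := by exact_mod_cast hN
  set T := Finset.univ.filter (fun K => ∀ k₁ : Fin d → Fin N, iota R k₁ s ≠ K) with hTdef
  set ξ : (Fin d → Fin (R * N)) → Fin d → (Fin d → Fin (R * N)) → ℝ := fun K μ K' =>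
    ‖dSym (R * N) K s ν * xEnt (R * N) a μ s K K'‖ with hξdef
  set ρ : (Fin d → Fin (R * N)) → Fin d → (Fin d → Fin (R * N)) → Fin d → ℝ := fun K μ K' μ' =>
    ‖dSym (R * N) K s ν * rEnt (R * N) a μ μ' s K K'‖ with hρdef
  have hpt : ∀ K ∈ T, ∀ (μ : Fin d) (K' : Fin d → Fin (R * N)) (μ' : Fin d),
      ‖Xdiff N R hN hRN a ha s hs hs0 ν (K, μ) (K', μ')
          - (if (K, μ) = (K', μ') then Dg N R s ν K else 0)‖ ^ 2
        ≤ (if μ = μ' then 2 * ξ K μ K' ^ 2 else 0) + 2 * ρ K μ K' μ' ^ 2 := by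
    intro K hK μ K' μ'
    have hu := (Finset.mem_filter.mp hK).2
    exact sq_le_two_ite (norm_nonneg _) (norm_nonneg _) (norm_nonneg _)
      (entry_unpaired_le hN hRN a ha hs hs0 ν hu μ K' μ')
  have hX : ∀ μ : Fin d, ∑ K ∈ T, ∑ K' : Fin d → Fin (R * N), 2 * ξ K μ K' ^ 2
      ≤ 2 * (CxU d / (N : ℝ) ^ 2) := fun μ => by
    rw [sum_sum_const_mul]
    exact mul_le_mul_of_nonneg_left (xUnpRow_weight_hs_le hN hR a ha μ hs ν₀ hν₀ ν) (by norm_num)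
  have hRr : ∀ μ μ' : Fin d, ∑ K ∈ T, ∑ K' : Fin d → Fin (R * N), 2 * ρ K μ K' μ' ^ 2
      ≤ 2 * (CrU d a / (N : ℝ) ^ 2) := fun μ μ' => by
    rw [sum_sum_const_mul]
    exact mul_le_mul_of_nonneg_left (rUnpRow_weight_hs_le hN hR a ha μ μ' hs ν₀ hν₀ ν) (by norm_num)
  calc _ ≤ ∑ K ∈ T, ∑ μ : Fin d, ∑ K' : Fin d → Fin (R * N), ∑ μ' : Fin d,
            ((if μ = μ' then 2 * ξ K μ K' ^ 2 else 0) + 2 * ρ K μ K' μ' ^ 2) :=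
        Finset.sum_le_sum fun K hK => Finset.sum_le_sum fun μ _ => Finset.sum_le_sum fun K' _ =>
          Finset.sum_le_sum fun μ' _ => hpt K hK μ K' μ'
    _ = ∑ K ∈ T, ∑ μ : Fin d,
          (∑ K' : Fin d → Fin (R * N), 2 * ξ K μ K' ^ 2
            + ∑ μ' : Fin d, ∑ K' : Fin d → Fin (R * N), 2 * ρ K μ K' μ' ^ 2) :=
        Finset.sum_congr rfl fun K _ => Finset.sum_congr rfl fun μ _ =>
          sum_sum_ite_add' Finset.univ μ (fun K' => 2 * ξ K μ K' ^ 2) (fun μ' K' => 2 * ρ K μ K' μ' ^ 2)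
    _ = ∑ μ : Fin d, ∑ K ∈ T,
          (∑ K' : Fin d → Fin (R * N), 2 * ξ K μ K' ^ 2
            + ∑ μ' : Fin d, ∑ K' : Fin d → Fin (R * N), 2 * ρ K μ K' μ' ^ 2) := Finset.sum_comm
    _ = ∑ μ : Fin d, (∑ K ∈ T, ∑ K' : Fin d → Fin (R * N), 2 * ξ K μ K' ^ 2
          + ∑ μ' : Fin d, ∑ K ∈ T, ∑ K' : Fin d → Fin (R * N), 2 * ρ K μ K' μ' ^ 2) :=
        Finset.sum_congr rfl fun μ _ => by
          rw [Finset.sum_add_distrib]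
          congr 1
          exact Finset.sum_comm
    _ ≤ ∑ μ : Fin d, (2 * (CxU d / (N : ℝ) ^ 2) + ∑ μ' : Fin d, 2 * (CrU d a / (N : ℝ) ^ 2)) :=
        Finset.sum_le_sum fun μ _ => add_le_add (hX μ) (Finset.sum_le_sum fun μ' _ => hRr μ μ')
    _ = d * (2 * CxU d + d * (2 * CrU d a)) / (N : ℝ) ^ 2 := by
        simp only [Finset.sum_const, Finset.card_univ, Fintype.card_fin]
        ring

end Sums

/-! ## §4 THE ORDER-ONE OPERATOR eta-RATE: the Hilbert–Schmidt total, the assembly, the residual discharged [folklore] -/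

section Assembly

variable {N R : ℕ} [NeZero N] [NeZero R]

/-- the total squared Hilbert–Schmidt constant of `X − D`. [folklore] -/
def Chs (d : ℕ) (a : ℝ) : ℝ :=
  d * (2 * CPPx d a + d * (2 * (((4 * d + a) / a) ^ 2 * CrrR d a)))
    + d * (2 * CxU' d + d * (2 * CrU' d a)) + d * (2 * CxU d + d * (2 * CrU d a))

omit [NeZero N] [NeZero R] in
/-- `0 ≤ Chs` and its three summands. [folklore] -/
theorem Chs_nonneg (d : ℕ) (a : ℝ) :
    0 ≤ d * (2 * CPPx d a + d * (2 * (((4 * d + a) / a) ^ 2 * CrrR d a)))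
      ∧ 0 ≤ d * (2 * CxU' d + d * (2 * CrU' d a)) ∧ 0 ≤ d * (2 * CxU d + d * (2 * CrU d a))
      ∧ 0 ≤ Chs d a := by
  obtain ⟨⟨h1, h2, h3, h4⟩, ⟨h5, h6, h7, h8⟩⟩ := consts_nonneg d a
  have hP : 0 ≤ CPPx d a := by unfold CPPx; positivity
  refine ⟨by positivity, by positivity, by positivity, ?_⟩
  unfold Chs; positivity

/-- **TOTAL squared Hilbert–Schmidt norm of `X − D`: `Σ_i Σ_j ‖X_{ij} − [i=j]D(i)‖² ≤ Chs/N²`** — rows and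
columns split by King's pairing (`sum_split_iota`), the three regions `hs_paired_paired_le`,
`hs_paired_unpaired_le` (`N⁻⁴ ≤ N⁻²`), `hs_unpaired_le`. [cite: King1986, (4.19)–(4.23) p.672] [folklore] -/
theorem hs_total_le (hN : 1 ≤ N) (hR : 1 ≤ R) (hRN : 1 ≤ R * N) (a : ℝ) (ha : 0 < a)
    {s : Fin d → ℝ} (hs : ∀ ν, |s ν| ≤ Real.pi) (hs0 : s ≠ 0) (ν₀ : Fin d) (hν₀ : s ν₀ ≠ 0) (ν : Fin d) :
    ∑ i, ∑ j, ‖Xdiff N R hN hRN a ha s hs hs0 ν i j - (if i = j then Dg N R s ν i.1 else 0)‖ ^ 2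
      ≤ Chs d a / (N : ℝ) ^ 2 := by
  classical
  have hN0 : (0 : ℝ) < N := by exact_mod_cast hN
  have hN1 : (1 : ℝ) ≤ N := by exact_mod_cast hN
  obtain ⟨_, hPU, _, _⟩ := Chs_nonneg d a
  simp only [Fintype.sum_prod_type]
  rw [sum_split_iota hN hs (fun K => ∑ μ : Fin d, ∑ K' : Fin d → Fin (R * N), ∑ μ' : Fin d,
    ‖Xdiff N R hN hRN a ha s hs hs0 ν (K, μ) (K', μ') - (if (K, μ) = (K', μ') then Dg N R s ν K else 0)‖ ^ 2)]
  have e1 : ∑ k : Fin d → Fin N, ∑ μ : Fin d, ∑ K' : Fin d → Fin (R * N), ∑ μ' : Fin d,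
        ‖Xdiff N R hN hRN a ha s hs hs0 ν (iota R k s, μ) (K', μ')
            - (if (iota R k s, μ) = (K', μ') then Dg N R s ν (iota R k s) else 0)‖ ^ 2
      = ∑ k : Fin d → Fin N, ∑ μ : Fin d,
          (∑ k' : Fin d → Fin N, ∑ μ' : Fin d,
              ‖Xdiff N R hN hRN a ha s hs hs0 ν (iota R k s, μ) (iota R k' s, μ')
                  - (if (iota R k s, μ) = (iota R k' s, μ') then Dg N R s ν (iota R k s) else 0)‖ ^ 2
            + ∑ K' ∈ Finset.univ.filter (fun K' => ∀ k₁ : Fin d → Fin N, iota R k₁ s ≠ K'), ∑ μ' : Fin d,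
              ‖Xdiff N R hN hRN a ha s hs hs0 ν (iota R k s, μ) (K', μ')
                  - (if (iota R k s, μ) = (K', μ') then Dg N R s ν (iota R k s) else 0)‖ ^ 2) :=
    Finset.sum_congr rfl fun k _ => Finset.sum_congr rfl fun μ _ => sum_split_iota hN hs _
  rw [e1]
  simp only [Finset.sum_add_distrib]
  have hsq : (N : ℝ) ^ 2 ≤ (N : ℝ) ^ 4 := by
    calc (N : ℝ) ^ 2 = (N : ℝ) ^ 2 * 1 := by ring
      _ ≤ (N : ℝ) ^ 2 * (N : ℝ) ^ 2 := by gcongr; nlinarith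
      _ = (N : ℝ) ^ 4 := by ring
  calc _ ≤ d * (2 * CPPx d a + d * (2 * (((4 * d + a) / a) ^ 2 * CrrR d a))) / (N : ℝ) ^ 2
            + d * (2 * CxU' d + d * (2 * CrU' d a)) / (N : ℝ) ^ 4
          + d * (2 * CxU d + d * (2 * CrU d a)) / (N : ℝ) ^ 2 :=
        add_le_add (add_le_add (hs_paired_paired_le hN hR hRN a ha hs hs0 ν₀ hν₀ ν)
          (hs_paired_unpaired_le hN hR hRN a ha hs hs0 ν₀ hν₀ ν)) (hs_unpaired_le hN hR hRN a ha hs hs0 ν₀ hν₀ ν)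
    _ ≤ d * (2 * CPPx d a + d * (2 * (((4 * d + a) / a) ^ 2 * CrrR d a))) / (N : ℝ) ^ 2
            + d * (2 * CxU' d + d * (2 * CrU' d a)) / (N : ℝ) ^ 2
          + d * (2 * CxU d + d * (2 * CrU d a)) / (N : ℝ) ^ 2 := by
        gcongr _ + ?_ + _
        exact div_le_div_of_nonneg_left hPU (by positivity) hsq
    _ = Chs d a / (N : ℝ) ^ 2 := by unfold Chs; ring

/-- the constant of the order-one operator eta-rate (left weight). [folklore] -/
def Casm (d : ℕ) (a : ℝ) : ℝ := Cdg + Real.pi / 4 + Real.sqrt (Chs d a)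

/-- **THE ORDER-ONE OPERATOR eta-RATE OF BAŁABAN'S `∇G` (1.83)/(1.89) AT `U = 1`, LEFT WEIGHT.** For
`N, R ≥ 1`, `a > 0`, a nonzero reduced momentum `p′ = s` of the zone and a direction `ν`:
`‖D_{∂^{(RN)}_ν} G^{(RN)}(p′) − plant_R(D_{∂^{(N)}_ν} G^{(N)}(p′))‖_op ≤ Casm(d,a)/N` on `l2` of the level-`RN`
alias classes `× Fin d` — «free diagonal by sup (`norm_Dg_le`) + the rest by Hilbert–Schmidt
(`hs_total_le`)», `B5G183RateL2Op.opNorm_le_diag_add_hs'`. The uniform companion is b05's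
`B5Prop11Fiber.opNorm_D_G_le`. Print ([Balaban1984PropagatorsI] Prop. 1.1) states the uniform bound only;
the rate, the pairing and every constant are OURS. [cite: Balaban1984PropagatorsI, (1.83) p.31, Prop. 1.1
(1.89) p.33; King1986, (4.19)–(4.24) p.672] [folklore] -/
theorem opNorm_D_G_rate (hN : 1 ≤ N) (hR : 1 ≤ R) (hRN : 1 ≤ R * N) (a : ℝ) (ha : 0 < a)
    {s : Fin d → ℝ} (hs : ∀ ν, |s ν| ≤ Real.pi) (hs0 : s ≠ 0) (ν : Fin d) :
    ‖Xdiff N R hN hRN a ha s hs hs0 ν‖ ≤ Casm d a / N := by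
  classical
  obtain ⟨ν₀, hν₀⟩ : ∃ ν, s ν ≠ 0 := Function.ne_iff.mp hs0
  have hN0 : (0 : ℝ) < N := by exact_mod_cast hN
  have hChs := (Chs_nonneg d a).2.2.2
  have hδ : 0 ≤ (Cdg + Real.pi / 4) / N := div_nonneg (add_nonneg Cdg_nonneg (by positivity)) hN0.le
  have hB : 0 ≤ Real.sqrt (Chs d a) / N := by positivity
  have key := opNorm_le_diag_add_hs' (Xdiff N R hN hRN a ha s hs hs0 ν) (fun i => Dg N R s ν i.1) hδ hB
    (fun i => norm_Dg_le hN hR hs ν₀ hν₀ ν i.1) (by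
      rw [div_pow, Real.sq_sqrt hChs]
      exact hs_total_le hN hR hRN a ha hs hs0 ν₀ hν₀ ν)
  calc _ ≤ (Cdg + Real.pi / 4) / N + Real.sqrt (Chs d a) / N := key
    _ = Casm d a / N := by unfold Casm; ring

/-- **THE TYPED RESIDUAL S2 (left weight) of `B5G183RateL2Op` IS DISCHARGED:**
`OrderOneOpRateResidualL d a (Casm d a)` holds for every `d` and `a` (the hypothesis `0 < a` is inside the
residual). [cite: Balaban1984PropagatorsI, Prop. 1.1 (1.89) p.33] [folklore] -/
theorem orderOneOpRateResidualL_holds (d : ℕ) (a : ℝ) : OrderOneOpRateResidualL d a (Casm d a) := by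
  intro N R _ _ hN hRN ha s hs hs0 ν hR
  exact opNorm_D_G_rate hN hR hRN a ha hs hs0 ν

end Assembly

/-! ## §5 The RIGHT weight (`G∇*` of (1.89)) by hermiticity [folklore] -/

section Right

variable {N R : ℕ} [NeZero N] [NeZero R]

omit [NeZero N] [NeZero R] in
/-- for a Hermitian block matrix, the right-weighted sandwich is the adjoint of the left-weighted one:
`D_1 A D_w^* = (D_w A D_1^*)^*`. [folklore] -/
theorem sandwich_right_eq_conjTranspose {Λ : Type*} (w : Λ → ℂ) {A : Matrix (Λ × Fin d) (Λ × Fin d) ℂ}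
    (hA : A.IsHermitian) :
    sandwich (fun _ => (1 : ℂ)) w A = (sandwich w (fun _ => (1 : ℂ)) A).conjTranspose := by
  ext i j
  have h : (starRingEnd ℂ) (A j i) = A i j := by simpa using hA.apply i j
  simp only [sandwich, Matrix.conjTranspose_apply, one_mul, map_one, mul_one, star_mul',
    Complex.star_def]
  rw [h, mul_comm]

omit [NeZero N] in
/-- planting commutes with the adjoint. [folklore] -/
theorem plant_conjTranspose {s : Fin d → ℝ}
    (M : Matrix ((Fin d → Fin N) × Fin d) ((Fin d → Fin N) × Fin d) ℂ) :
    plant R s M.conjTranspose = (plant R s M).conjTranspose := by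
  ext i j
  rw [Matrix.conjTranspose_apply]
  unfold plant
  cases h1 : unpair R s i.1 <;> cases h2 : unpair R s j.1 <;> simp [Matrix.conjTranspose_apply]

/-- **THE ORDER-ONE OPERATOR eta-RATE, RIGHT WEIGHT** (`G∇*` of (1.89)): the right-weighted difference is the
adjoint of the left-weighted one (b05's `G_isHermitian`, `plant_conjTranspose`), and the `l2` operator norm
is invariant under the adjoint (`Matrix.l2_opNorm_conjTranspose`). [cite: Balaban1984PropagatorsI, Prop. 1.1
(1.89) p.33] [folklore] -/
theorem opNorm_G_D_rate (hN : 1 ≤ N) (hR : 1 ≤ R) (hRN : 1 ≤ R * N) (a : ℝ) (ha : 0 < a)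
    {s : Fin d → ℝ} (hs : ∀ ν, |s ν| ≤ Real.pi) (hs0 : s ≠ 0) (ν : Fin d) :
    ‖sandwich (fun _ => (1 : ℂ)) (fun k'' => dSym (R * N) k'' s ν) (balabanFiber (R * N) hRN a ha s hs hs0).G
        - plant R s (sandwich (fun _ => (1 : ℂ)) (fun k => dSym N k s ν) (balabanFiber N hN a ha s hs hs0).G)‖
      ≤ Casm d a / N := by
  classical
  rw [sandwich_right_eq_conjTranspose _ (G_isHermitian (R * N) hRN a ha s hs hs0),
    sandwich_right_eq_conjTranspose _ (G_isHermitian N hN a ha s hs hs0), plant_conjTranspose,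
    ← Matrix.conjTranspose_sub, Matrix.l2_opNorm_conjTranspose]
  exact opNorm_D_G_rate hN hR hRN a ha hs hs0 ν

/-- **THE TYPED RESIDUAL S2 (right weight) of `B5G183RateL2Op` IS DISCHARGED:**
`OrderOneOpRateResidualR d a (Casm d a)`. [cite: Balaban1984PropagatorsI, Prop. 1.1 (1.89) p.33] [folklore] -/
theorem orderOneOpRateResidualR_holds (d : ℕ) (a : ℝ) : OrderOneOpRateResidualR d a (Casm d a) := by
  intro N R _ _ hN hRN ha s hs hs0 ν hR
  exact opNorm_G_D_rate hN hR hRN a ha hs hs0 ν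

/-- **SUMMARY (order-one items of (1.89) at `U = 1`, linear theory): uniform bound AND eta-rate** for both
weights — `‖D_∂ G^{(n)}‖, ‖G^{(n)} D_∂^*‖ ≤ γ₀(d,a)` for every level `n` (b05), and the level-`N` to level-`RN`
differences after planting are `≤ Casm(d,a)/N`. [cite: Balaban1984PropagatorsI, Prop. 1.1 (1.89) p.33;
King1986, §4 pp.671–673] [folklore] -/
theorem orderOne_uniform_and_rate (hN : 1 ≤ N) (hR : 1 ≤ R) (hRN : 1 ≤ R * N) (a : ℝ) (ha : 0 < a)
    {s : Fin d → ℝ} (hs : ∀ ν, |s ν| ≤ Real.pi) (hs0 : s ≠ 0) (ν : Fin d) :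
    (‖sandwich (fun k => dSym (R * N) k s ν) (fun _ => (1 : ℂ)) (balabanFiber (R * N) hRN a ha s hs hs0).G‖
        ≤ gamma0 d a
      ∧ ‖sandwich (fun _ => (1 : ℂ)) (fun k => dSym (R * N) k s ν) (balabanFiber (R * N) hRN a ha s hs hs0).G‖
        ≤ gamma0 d a)
      ∧ ‖Xdiff N R hN hRN a ha s hs hs0 ν‖ ≤ Casm d a / N
      ∧ ‖sandwich (fun _ => (1 : ℂ)) (fun k'' => dSym (R * N) k'' s ν) (balabanFiber (R * N) hRN a ha s hs hs0).G
          - plant R s (sandwich (fun _ => (1 : ℂ)) (fun k => dSym N k s ν) (balabanFiber N hN a ha s hs hs0).G)‖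
        ≤ Casm d a / N :=
  ⟨opNorm_D_G_uniform (R * N) hRN a ha s hs hs0 ν, opNorm_D_G_rate hN hR hRN a ha hs hs0 ν,
    opNorm_G_D_rate hN hR hRN a ha hs hs0 ν⟩

end Right

end Literature.MathematicalPhysics.QuantumFieldTheory.Balaban1983to89.B5G183RateL2Asm
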